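import Summits.SmoothPoincare4.SmoothPoincare4.Theorems.ConvexBisectionAcyclicBisectionExistsBeltMonodromyCharts
import Summits.SmoothPoincare4.SmoothPoincare4.Theorems.ConvexBisectionAcyclicBisectionExistsSeamTwistSignPageDet
import Summits.SmoothPoincare4.SmoothPoincare4.Theorems.ConvexBisectionAcyclicBisectionExistsOrseamPageDet
import Summits.SmoothPoincare4.SmoothPoincare4.Theorems.ConvexBisectionAcyclicBisectionExistsHgapTwistModel
import HarnessLib

/-!
# N1 ▸ `node_N1_move` ▸ (d) N1-mono, brick H4-5: THE TRANSPORTED CHARTS ARE POSITIVELY ORIENTED AT EVERY LEVEL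
(wave 7, crux stmt-SmoothPoincare4-10508, line `modp-braid-orbits`, registered stub `stub_M2geo` (N1) ▸
`node_N1_move` ▸ sub-node (d); registered sub-goal `helper_exists_orientedChartFamily`)

(d) v5 (`work/stubs/H4H7_interface.lean`) takes as input a fibred family of N1a charts of the pages
`d k · e^{iσ}`, `|σ| ≤ η₁`, POSITIVELY ORIENTED AT EVERY LEVEL; H4-2 (`…BeltMonodromyCharts.lean`) built
`φ (u,r,σ) := R_{σ/κ} (φ₀ (u, ε r))` from Z4's rigid page rotation (flow `θ` of `κ · rotField`) and G7's chart,
with the orientation certified at the level `0`.  Here it is transported to ALL levels: §1 a linear map of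
POSITIVE page determinant `pageDet g Λ q = ⟪Λ (iτ), i Λ τ⟫` (X3) preserves the sign of `⟪a, ib⟫` on the page
line `L_q = ker dΦ_q`; §2 the spatial differential `Λ_t = ∂_x θ (t,·)` of the flow at a page point maps `L_q`
into `L_{θ_t q}`, is injective, continuous in `t`, `Λ_0 = id`, so `pageDet g Λ_t q > 0` (X3
`pageDet_pos_of_path`); §3 hence `θ_t ∘ φ₀` is positively oriented, and **the input of (d) v5 exists**
(`exists_orientedChartFamily`, registered `helper_exists_orientedChartFamily`).  Everything is proved; no
named facts, no `sorry`.  References: P. Griffiths, J. Harris, *Principles of Algebraic Geometry* (1978),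
Ch. 0 §2 [GriffithsHarris1978]; A. A. Kosinski, *Differential Manifolds* (1993), III (3.1) [Kosinski1993].
-/

noncomputable section

set_option linter.dupNamespace false

open scoped Manifold ContDiff Topology
open Set Function Metric Complex
open Literature.Topology.FourManifolds Literature.Topology.FourManifolds.LefschetzBase

namespace Summit.SmoothPoincare4.SmoothPoincare4.Theorems.AcyclicBisectionExists.ModpBraidOrbits

variable {g : ℕ}

/-! ## §1 The Kähler pairing under a map of positive page determinant -/

/-- **A map of positive page determinant preserves the sign of the Kähler pairing on the page line**:
for `a, b ∈ L_q` with `⟪a, ib⟫ > 0` and `pageDet g Λ q > 0`, `⟪Λ a, i Λ b⟫ > 0`.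
[cite: GriffithsHarris1978, Ch. 0 §2] -/
theorem inner_cplxJ_map_pos {q a b : EuclideanSpace ℝ (Fin 4)} (hq : q ≠ 0)
    (Λ : EuclideanSpace ℝ (Fin 4) →L[ℝ] EuclideanSpace ℝ (Fin 4))
    (ha : dPhiX g q * cx a + dPhiY q * cy a = 0) (hb : dPhiX g q * cx b + dPhiY q * cy b = 0)
    (hab : 0 < inner ℝ a (cplxJ b)) (hdet : 0 < pageDet g Λ q) :
    0 < inner ℝ (Λ a) (cplxJ (Λ b)) := by
  obtain ⟨za, hza⟩ := exists_eq_comb_pageVec (g := g) hq ha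
  obtain ⟨zb, hzb⟩ := exists_eq_comb_pageVec (g := g) hq hb
  set τ := pageVec g q with hτ
  have hab' : inner ℝ a (cplxJ b) = (za.im * zb.re - za.re * zb.im) * ‖τ‖ ^ 2 := by
    rw [hza, hzb, inner_comb_cplxJ_comb, inner_cplxJ_cplxJ_eq, real_inner_self_eq_norm_sq]
  have hτ0 : τ ≠ 0 := pageVec_ne_zero hq
  have hk : 0 < za.im * zb.re - za.re * zb.im := by
    rw [hab'] at hab
    have hn : 0 < ‖τ‖ ^ 2 := by positivity
    exact pos_of_mul_pos_left hab hn.le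
  have hΛ : inner ℝ (Λ a) (cplxJ (Λ b)) = (za.im * zb.re - za.re * zb.im) * pageDet g Λ q := by
    rw [hza, hzb, map_add, map_smul, map_smul, map_add, map_smul, map_smul, inner_comb_cplxJ_comb]
    rfl
  rw [hΛ]
  exact mul_pos hk hdet

/-! ## §2 The spatial differential of a page-rotating flow -/

section Flow

variable {θ : ℝ × EuclideanSpace ℝ (Fin 4) → EuclideanSpace ℝ (Fin 4)} {κ : ℝ}

/-- The spatial differential of the flow: `x ↦ θ (t, x)` has derivative `(∂θ)(t, q) ∘ inr` at `q`. [folklore] -/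
theorem hasFDerivAt_flow_spatial (hθ : ContDiff ℝ ∞ θ) (t : ℝ) (q : EuclideanSpace ℝ (Fin 4)) :
    HasFDerivAt (fun x => θ (t, x))
      ((fderiv ℝ θ (t, q)).comp (ContinuousLinearMap.inr ℝ ℝ (EuclideanSpace ℝ (Fin 4)))) q := by
  have h1 : HasFDerivAt θ (fderiv ℝ θ (t, q)) (t, q) :=
    ((hθ.differentiable (by simp)) (t, q)).hasFDerivAt
  exact h1.comp q (hasFDerivAt_prodMk_right t q)

/-- The spatial differential of the flow is continuous in time. [folklore] -/
theorem continuous_flow_spatial_fderiv (hθ : ContDiff ℝ ∞ θ) (q : EuclideanSpace ℝ (Fin 4)) :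
    Continuous fun t : ℝ => fderiv ℝ (fun x => θ (t, x)) q := by
  have e : (fun t : ℝ => fderiv ℝ (fun x => θ (t, x)) q) =
      fun t => (fderiv ℝ θ (t, q)).comp (ContinuousLinearMap.inr ℝ ℝ (EuclideanSpace ℝ (Fin 4))) :=
    funext fun t => (hasFDerivAt_flow_spatial hθ t q).fderiv
  rw [e]
  have h1 : Continuous fun t : ℝ => fderiv ℝ θ (t, q) :=
    (hθ.continuous_fderiv (by simp)).comp (continuous_id.prodMk continuous_const)
  exact h1.clm_comp continuous_const

/-- **The flow preserves the page lines**: if `w (θ_t x) = e^{iκt} w x` for `rho x ≤ 3/10`, then along any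
differentiable curve `γ` in a flat page the velocity of `θ_t ∘ γ` lies in `L_{θ_t (γ r)}`.
[cite: Kosinski1993, III (3.1)] -/
theorem dPhi_flow_velocity_eq_zero (hθ : ContDiff ℝ ∞ θ)
    (hw : ∀ x, rho g x ≤ 3 / 10 → ∀ t, w g (θ (t, x)) = Complex.exp (Complex.I * κ * t) * w g x)
    {γ : ℝ → EuclideanSpace ℝ (Fin 4)} {c : ℂ} (hγw : ∀ r, w g (γ r) = c / 2) (hγρ : ∀ r, rho g (γ r) ≤ 3 / 10)
    {a : EuclideanSpace ℝ (Fin 4)} {r : ℝ} (ha : HasDerivAt γ a r) (t : ℝ) :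
    dPhiX g (θ (t, γ r)) * cx (fderiv ℝ (fun x => θ (t, x)) (γ r) a) +
      dPhiY (θ (t, γ r)) * cy (fderiv ℝ (fun x => θ (t, x)) (γ r) a) = 0 := by
  have hΛ : HasFDerivAt (fun x => θ (t, x)) (fderiv ℝ (fun x => θ (t, x)) (γ r)) (γ r) :=
    (hasFDerivAt_flow_spatial hθ t (γ r)).differentiableAt.hasFDerivAt
  have hc : HasDerivAt (fun r' => θ (t, γ r')) (fderiv ℝ (fun x => θ (t, x)) (γ r) a) r :=
    hΛ.comp_hasDerivAt r ha
  have h1 := hasDerivAt_w_comp (g := g) hc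
  have h2 : HasDerivAt (fun r' => w g (θ (t, γ r'))) 0 r := by
    have e : (fun r' => w g (θ (t, γ r'))) = fun _ => Complex.exp (Complex.I * κ * t) * (c / 2) :=
      funext fun r' => by rw [hw _ (hγρ r') t, hγw]
    rw [e]; exact hasDerivAt_const r _
  exact h1.unique h2 ▸ rfl

/-- **The spatial differential is injective** (the flow is a group: `θ_{−t} ∘ θ_t = id`). [folklore] -/
theorem injective_flow_spatial (hθ : ContDiff ℝ ∞ θ) (h0 : ∀ x, θ (0, x) = x)
    (hadd : ∀ t s x, θ (t, θ (s, x)) = θ (t + s, x)) (t : ℝ) (q : EuclideanSpace ℝ (Fin 4)) :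
    Injective (fderiv ℝ (fun x => θ (t, x)) q) := by
  have hΛ : HasFDerivAt (fun x => θ (t, x)) (fderiv ℝ (fun x => θ (t, x)) q) q :=
    (hasFDerivAt_flow_spatial hθ t q).differentiableAt.hasFDerivAt
  have hM : HasFDerivAt (fun x => θ (-t, x)) (fderiv ℝ (fun x => θ (-t, x)) (θ (t, q))) (θ (t, q)) :=
    (hasFDerivAt_flow_spatial hθ (-t) (θ (t, q))).differentiableAt.hasFDerivAt
  have hcomp := hM.comp q hΛ
  have e : ((fun x => θ (-t, x)) ∘ fun x => θ (t, x)) = id := by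
    funext x
    show θ (-t, θ (t, x)) = x
    rw [hadd, neg_add_cancel, h0]
  rw [e] at hcomp
  have hid := hcomp.unique (hasFDerivAt_id q)
  intro v v' hvv
  have := congrArg (fderiv ℝ (fun x => θ (-t, x)) (θ (t, q))) hvv
  rw [← ContinuousLinearMap.comp_apply, ← ContinuousLinearMap.comp_apply, hid] at this
  exact this

/-- `dΦ` is linear in the vector: `dΦ_q (α X + β Y) = α dΦ_q X + β dΦ_q Y`. [folklore] -/
theorem dPhi_lin (q X Y : EuclideanSpace ℝ (Fin 4)) (α β : ℝ) :
    dPhiX g q * cx (α • X + β • Y) + dPhiY q * cy (α • X + β • Y) =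
      (α : ℂ) * (dPhiX g q * cx X + dPhiY q * cy X) + (β : ℂ) * (dPhiX g q * cx Y + dPhiY q * cy Y) := by
  rw [cx_add, cy_add, cx_smul, cx_smul, cy_smul, cy_smul]
  ring

/-- **A linear map sending two independent page tangents into a page line sends the whole page line
there.** [cite: GriffithsHarris1978, Ch. 0 §2] -/
theorem dPhi_map_eq_zero_of_two {q q' a b : EuclideanSpace ℝ (Fin 4)} (hq : q ≠ 0)
    (Λ : EuclideanSpace ℝ (Fin 4) →L[ℝ] EuclideanSpace ℝ (Fin 4))
    (ha : dPhiX g q * cx a + dPhiY q * cy a = 0) (hb : dPhiX g q * cx b + dPhiY q * cy b = 0)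
    (hab : 0 < inner ℝ a (cplxJ b))
    (hLa : dPhiX g q' * cx (Λ a) + dPhiY q' * cy (Λ a) = 0)
    (hLb : dPhiX g q' * cx (Λ b) + dPhiY q' * cy (Λ b) = 0)
    {Y : EuclideanSpace ℝ (Fin 4)} (hY : dPhiX g q * cx Y + dPhiY q * cy Y = 0) :
    dPhiX g q' * cx (Λ Y) + dPhiY q' * cy (Λ Y) = 0 := by
  have ha0 : a ≠ 0 := by
    rintro rfl
    rw [inner_zero_left] at hab
    exact lt_irrefl _ hab
  obtain ⟨α, β, hbab⟩ := exists_combo_of_pageTangent (g := g) hq ha0 ha hb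
  have hβ : β ≠ 0 := by
    rintro rfl
    rw [zero_smul, add_zero] at hbab
    rw [hbab, cplxJ_smul, real_inner_smul_right, inner_cplxJ_self, mul_zero] at hab
    exact lt_irrefl _ hab
  have hJa : cplxJ a = β⁻¹ • b + (-(β⁻¹ * α)) • a := by
    rw [hbab, smul_add, smul_smul, smul_smul, inv_mul_cancel₀ hβ, one_smul, neg_smul]
    abel
  have hLJa : dPhiX g q' * cx (Λ (cplxJ a)) + dPhiY q' * cy (Λ (cplxJ a)) = 0 := by
    rw [hJa, map_add, map_smul, map_smul, dPhi_lin, hLa, hLb, mul_zero, mul_zero, add_zero]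
  obtain ⟨α', β', hY'⟩ := exists_combo_of_pageTangent (g := g) hq ha0 ha hY
  rw [hY', map_add, map_smul, map_smul, dPhi_lin, hLa, hLJa, mul_zero, mul_zero, add_zero]

/-- **The page determinant of the flow is positive** at a flat page point through which two page curves
with independent velocities `a`, `b` pass (so that `Λ_t (L_q) ⊆ L_{θ_t q}` for the spatial differential
`Λ_t`): continuity in `t`, non-vanishing (X3 `pageDet_ne_zero`), `Λ_0 = id` (X3 `pageDet_pos_of_path`).
[cite: GriffithsHarris1978, Ch. 0 §2] -/
theorem pageDet_flow_pos (hθ : ContDiff ℝ ∞ θ) (h0 : ∀ x, θ (0, x) = x)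
    (hadd : ∀ t s x, θ (t, θ (s, x)) = θ (t + s, x))
    (hw : ∀ x, rho g x ≤ 3 / 10 → ∀ t, w g (θ (t, x)) = Complex.exp (Complex.I * κ * t) * w g x)
    {q a b : EuclideanSpace ℝ (Fin 4)} {c : ℂ} (hc : ‖c‖ = 1) (hqw : w g q = c / 2)
    (hqρ : rho g q ≤ 3 / 10)
    (ha : dPhiX g q * cx a + dPhiY q * cy a = 0) (hb : dPhiX g q * cx b + dPhiY q * cy b = 0)
    (hab : 0 < inner ℝ a (cplxJ b))
    (hLa : ∀ t, dPhiX g (θ (t, q)) * cx (fderiv ℝ (fun x => θ (t, x)) q a) +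
      dPhiY (θ (t, q)) * cy (fderiv ℝ (fun x => θ (t, x)) q a) = 0)
    (hLb : ∀ t, dPhiX g (θ (t, q)) * cx (fderiv ℝ (fun x => θ (t, x)) q b) +
      dPhiY (θ (t, q)) * cy (fderiv ℝ (fun x => θ (t, x)) q b) = 0) (t : ℝ) :
    0 < pageDet g (fderiv ℝ (fun x => θ (t, x)) q) q := by
  have hq : q ≠ 0 := ne_zero_of_w_eq_half hc hqw
  have hq' : ∀ t', θ (t', q) ≠ 0 := fun t' => by
    have hw' : w g (θ (t', q)) = (Complex.exp (Complex.I * κ * t') * c) / 2 := by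
      rw [hw q hqρ t', hqw]; ring
    have he : ‖Complex.exp (Complex.I * κ * t') * c‖ = 1 := by
      rw [norm_mul, hc, mul_one]
      have : Complex.I * κ * t' = ((κ * t' : ℝ) : ℂ) * Complex.I := by push_cast; ring
      rw [this, Complex.norm_exp_ofReal_mul_I]
    exact ne_zero_of_w_eq_half he hw'
  set Λ : ℝ → (EuclideanSpace ℝ (Fin 4) →L[ℝ] EuclideanSpace ℝ (Fin 4)) :=
    fun s => fderiv ℝ (fun x => θ (s * t, x)) q with hΛ
  have hcont : ContinuousOn (fun s => pageDet g (Λ s) q) (Icc 0 1) := by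
    have h1 : Continuous Λ := (continuous_flow_spatial_fderiv hθ q).comp (continuous_id.mul continuous_const)
    exact (continuous_pageDet_family h1 continuous_const).continuousOn
  have hne : ∀ s ∈ Icc (0 : ℝ) 1, pageDet g (Λ s) q ≠ 0 := by
    intro s _
    refine pageDet_ne_zero (Λ s) hq (hq' (s * t)) (fun X _ hX => injective_flow_spatial hθ h0 hadd (s * t) q
      (hX.trans (map_zero _).symm)) ?_ ?_
    · exact dPhi_map_eq_zero_of_two hq (Λ s) ha hb hab (hLa (s * t)) (hLb (s * t)) (dPhi_pageVec q)
    · exact dPhi_map_eq_zero_of_two hq (Λ s) ha hb hab (hLa (s * t)) (hLb (s * t)) (dPhi_cplxJ_pageVec q)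
  have hzero : 0 < pageDet g (Λ 0) q := by
    have e : Λ 0 = ContinuousLinearMap.id ℝ _ := by
      show fderiv ℝ (fun x => θ (0 * t, x)) q = _
      have e1 : (fun x => θ (0 * t, x)) = id := funext fun x => by rw [zero_mul]; exact h0 x
      rw [e1, fderiv_id]
    rw [e]; exact pageDet_id hq
  have h := pageDet_pos_of_path hcont hne hzero
  have e1 : Λ 1 = fderiv ℝ (fun x => θ (t, x)) q := by
    show fderiv ℝ (fun x => θ (1 * t, x)) q = _
    rw [one_mul]
  rwa [e1] at h

end Flow

/-! ## §3 Transport of an oriented chart by the flow; the oriented chart family -/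

/-- The velocity of a curve inside a page is a page tangent. [folklore] -/
theorem dPhi_velocity_eq_zero_of_w_const {γ : ℝ → EuclideanSpace ℝ (Fin 4)} {c : ℂ}
    (hγw : ∀ r, w g (γ r) = c / 2) {a : EuclideanSpace ℝ (Fin 4)} {r : ℝ} (ha : HasDerivAt γ a r) :
    dPhiX g (γ r) * cx a + dPhiY (γ r) * cy a = 0 := by
  have h1 := hasDerivAt_w_comp (g := g) ha
  have h2 : HasDerivAt (fun r' => w g (γ r')) 0 r := by
    have e : (fun r' => w g (γ r')) = fun _ => c / 2 := funext hγw
    rw [e]; exact hasDerivAt_const r _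
  exact h1.unique h2

/-- **The transport of a positively oriented page chart by a page-rotating flow is positively oriented.**
For the flow `θ` (group, `w (θ_t x) = e^{iκt} w x` near the boundary) and an N1a chart `φ₀` of the flat
page `page g c`, the chart `(u, r) ↦ θ_t (φ₀ (u, r))` satisfies `0 < ⟪∂_r, i ∂_u⟫` wherever `φ₀` does.
[cite: GriffithsHarris1978, Ch. 0 §2] -/
theorem chart_transport_oriented {θ : ℝ × EuclideanSpace ℝ (Fin 4) → EuclideanSpace ℝ (Fin 4)} {κ : ℝ}
    (hθ : ContDiff ℝ ∞ θ) (h0 : ∀ x, θ (0, x) = x) (hadd : ∀ t s x, θ (t, θ (s, x)) = θ (t + s, x))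
    (hw : ∀ x, rho g x ≤ 3 / 10 → ∀ t, w g (θ (t, x)) = Complex.exp (Complex.I * κ * t) * w g x)
    {c : ℂ} (hc : ‖c‖ = 1) {φ₀ : ℝ × ℝ → Base g} (hφs : ContMDiff 𝓘(ℝ, ℝ × ℝ) (𝓡∂ 4) ∞ φ₀)
    (hφp : ∀ p, φ₀ p ∈ page g c) {u r : ℝ}
    (hφo : 0 < inner ℝ (deriv (fun r' => (φ₀ (u, r')).1) r) (cplxJ (deriv (fun u' => (φ₀ (u', r)).1) u)))
    (t : ℝ) :
    0 < inner ℝ (deriv (fun r' => θ (t, (φ₀ (u, r')).1)) r)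
      (cplxJ (deriv (fun u' => θ (t, (φ₀ (u', r)).1)) u)) := by
  have hF : ContDiff ℝ ∞ (fun p : ℝ × ℝ => (φ₀ p).1) :=
    contMDiff_iff_contDiff.1 ((RegularSublevel.contMDiff_incl (isRegularLevel_rho g)).comp hφs)
  have hFr : ContDiff ℝ ∞ (fun r' : ℝ => (φ₀ (u, r')).1) := hF.comp (contDiff_const.prodMk contDiff_id)
  have hFu : ContDiff ℝ ∞ (fun u' : ℝ => (φ₀ (u', r)).1) := hF.comp (contDiff_id.prodMk contDiff_const)
  have haD : HasDerivAt (fun r' : ℝ => (φ₀ (u, r')).1) (deriv (fun r' => (φ₀ (u, r')).1) r) r :=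
    ((hFr.differentiable (by simp)) r).hasDerivAt
  have hbD : HasDerivAt (fun u' : ℝ => (φ₀ (u', r)).1) (deriv (fun u' => (φ₀ (u', r)).1) u) u :=
    ((hFu.differentiable (by simp)) u).hasDerivAt
  set q : EuclideanSpace ℝ (Fin 4) := (φ₀ (u, r)).1 with hq_def
  set a := deriv (fun r' => (φ₀ (u, r')).1) r with ha_def
  set b := deriv (fun u' => (φ₀ (u', r)).1) u with hb_def
  have hγw : ∀ p : ℝ × ℝ, w g (φ₀ p).1 = c / 2 := fun p => (hφp p).2
  have hγρ : ∀ p : ℝ × ℝ, rho g (φ₀ p).1 ≤ 3 / 10 := fun p => by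
    rw [rho_eq_of_mem_page g hc (hφp p)]; norm_num
  have hqw : w g q = c / 2 := hγw (u, r)
  have hqρ : rho g q ≤ 3 / 10 := hγρ (u, r)
  have hq : q ≠ 0 := ne_zero_of_w_eq_half hc hqw
  have ha : dPhiX g q * cx a + dPhiY q * cy a = 0 :=
    dPhi_velocity_eq_zero_of_w_const (γ := fun r' => (φ₀ (u, r')).1) (fun r' => hγw (u, r')) haD
  have hb : dPhiX g q * cx b + dPhiY q * cy b = 0 :=
    dPhi_velocity_eq_zero_of_w_const (γ := fun u' => (φ₀ (u', r)).1) (fun u' => hγw (u', r)) hbD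
  have hLa : ∀ t', dPhiX g (θ (t', q)) * cx (fderiv ℝ (fun x => θ (t', x)) q a) +
      dPhiY (θ (t', q)) * cy (fderiv ℝ (fun x => θ (t', x)) q a) = 0 := fun t' =>
    dPhi_flow_velocity_eq_zero hθ hw (γ := fun r' => (φ₀ (u, r')).1) (fun r' => hγw (u, r'))
      (fun r' => hγρ (u, r')) haD t'
  have hLb : ∀ t', dPhiX g (θ (t', q)) * cx (fderiv ℝ (fun x => θ (t', x)) q b) +
      dPhiY (θ (t', q)) * cy (fderiv ℝ (fun x => θ (t', x)) q b) = 0 := fun t' =>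
    dPhi_flow_velocity_eq_zero hθ hw (γ := fun u' => (φ₀ (u', r)).1) (fun u' => hγw (u', r))
      (fun u' => hγρ (u', r)) hbD t'
  have hdet := pageDet_flow_pos hθ h0 hadd hw hc hqw hqρ ha hb hφo hLa hLb t
  have hΛ : HasFDerivAt (fun x => θ (t, x)) (fderiv ℝ (fun x => θ (t, x)) q) q :=
    (hasFDerivAt_flow_spatial hθ t q).differentiableAt.hasFDerivAt
  have h1c := hΛ.comp_hasDerivAt r haD
  have h2c := hΛ.comp_hasDerivAt u hbD
  have e1 : deriv (fun r' => θ (t, (φ₀ (u, r')).1)) r = fderiv ℝ (fun x => θ (t, x)) q a := h1c.deriv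
  have e2 : deriv (fun u' => θ (t, (φ₀ (u', r)).1)) u = fderiv ℝ (fun x => θ (t, x)) q b := h2c.deriv
  rw [e1, e2]
  exact inner_cplxJ_map_pos hq _ ha hb hφo hdet

/-- **The oriented fibred chart family around an embedded page curve** (brick H4-5 = the INPUT of (d) v5).
As `exists_fibredChartFamily` (H4-2), with the orientation clause at EVERY level. [cite: Kosinski1993, III (3.1)] -/
theorem exists_orientedChartFamily (g : ℕ) {c : ℂ} (hc : ‖c‖ = 1)
    {K : sphere (0 : EuclideanSpace ℝ (Fin 2)) 1 → Base g}
    (hK : Manifold.IsSmoothEmbedding (𝓡 1) (𝓡∂ 4) ∞ K) (hKc : ∀ θ, K θ ∈ page g c)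
    {U : Set (Base g)} (hU : IsOpen U) (hKU : ∀ θ, K θ ∈ U) :
    ∃ (κ η₁ : ℝ) (R : AmbientIsotopy (𝓡∂ 4) (Base g)) (φ : ℝ × ℝ × ℝ → Base g), 0 < κ ∧ 0 < η₁ ∧
      (∀ (t s : ℝ) (p : Base g), R.toFun t (R.toFun s p) = R.toFun (t + s) p) ∧
      (∀ (t : ℝ) (c' : ℂ) (p : Base g), p ∈ page g c' →
        R.toFun t p ∈ page g (c' * Complex.exp (((κ * t : ℝ) : ℂ) * Complex.I))) ∧
      (∀ u r σ, φ (u, r, σ) = R.toFun (σ / κ) (φ (u, r, 0))) ∧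
      ContMDiff 𝓘(ℝ, ℝ × ℝ × ℝ) (𝓡∂ 4) ∞ φ ∧
      (∀ u r σ, φ (u + 1, r, σ) = φ (u, r, σ)) ∧
      (∀ u, φ (u, 0, 0) = K (circlePt u)) ∧
      (∀ (u r σ : ℝ), φ (u, r, σ) ∈ page g (c * Complex.exp ((σ : ℂ) * Complex.I))) ∧
      (∀ u r σ, r ∈ Ioo (-1 : ℝ) 1 → σ ∈ Icc (-η₁) η₁ → φ (u, r, σ) ∈ U) ∧
      (∀ σ : ℝ, InjOn (fun p : ℝ × ℝ => φ (p.1, p.2, σ)) (Ico (0 : ℝ) 1 ×ˢ Ioo (-1 : ℝ) 1)) ∧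
      (∀ (u r σ : ℝ), r ∈ Ioo (-1 : ℝ) 1 →
        0 < inner ℝ (deriv (fun r' => (φ (u, r', σ)).1) r)
          (cplxJ (deriv (fun u' => (φ (u', r, σ)).1) u))) := by
  obtain ⟨κ, r₀, R, θ, Φ, hκ, -, hθs, hθ0, hθadd, hRθ, -, -, hflat, hw, -, -, -, -⟩ :=
    helper_exists_pageTube g c K hc hK hKc
  have hflow : ∀ (t s : ℝ) (p : Base g), R.toFun t (R.toFun s p) = R.toFun (t + s) p := fun t s p => by
    apply Subtype.ext
    rw [hRθ, hRθ, hRθ, hθadd]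
  have hRpage : ∀ (t : ℝ) (c' : ℂ) (p : Base g), p ∈ page g c' →
      R.toFun t p ∈ page g (c' * Complex.exp (((κ * t : ℝ) : ℂ) * Complex.I)) := by
    intro t c' p hp
    obtain ⟨hpx, hpw⟩ := hp
    have hrho : rho g p.1 ≤ 3 / 10 := le_trans p.2 (by norm_num)
    refine ⟨?_, ?_⟩
    · rw [hRθ]; exact (hflat t p.1).2 hpx
    · rw [hRθ, hw p.1 hrho t, hpw]
      push_cast
      rw [mul_comm (Complex.exp _) (c' / 2), mul_div_right_comm]
      congr 1
      ring_nf
  obtain ⟨φ₀, hφs, hφ1, hφa, hφp, hφi, hφo⟩ := exists_chart_of_isSmoothEmbedding hc hK hKc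
  obtain ⟨ε₀, hε₀, hwidth⟩ : ∃ ε₀ > 0, ∀ u (q : ℝ × ℝ), dist q (0, 0) < ε₀ → R.toFun q.1 (φ₀ (u, q.2)) ∈ U := by
    refine exists_width_of_periodic (F := fun u q => R.toFun q.1 (φ₀ (u, q.2))) ?_ (fun u q => by
      show R.toFun q.1 (φ₀ (u + 1, q.2)) = R.toFun q.1 (φ₀ (u, q.2)); rw [hφ1]) hU (fun u => by
      show R.toFun 0 (φ₀ (u, 0)) ∈ U; rw [R.map_zero, id, hφa]; exact hKU _)
    have h1 : Continuous fun z : ℝ × (ℝ × ℝ) => ((z.2.1, φ₀ (z.1, z.2.2)) : ℝ × Base g) :=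
      (continuous_fst.comp continuous_snd).prodMk
        (hφs.continuous.comp (continuous_fst.prodMk (continuous_snd.comp continuous_snd)))
    exact R.contMDiff.continuous.comp h1
  set ε : ℝ := min (ε₀ / 2) 1 with hε_def
  have hε : 0 < ε := lt_min (by linarith) one_pos
  have hε1 : ε ≤ 1 := min_le_right _ _
  have hεε₀ : ε ≤ ε₀ / 2 := min_le_left _ _
  set η₁ : ℝ := κ * (ε₀ / 2) with hη₁_def
  have hη₁ : 0 < η₁ := mul_pos hκ (by linarith)
  obtain ⟨hts, ht1, hta, htp, hti, hto⟩ := chart_thin hφs hφ1 hφa hφp hφi hφo hε hε1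
  obtain ⟨φ, hφ⟩ : ∃ φ : ℝ × ℝ × ℝ → Base g, ∀ u r σ, φ (u, r, σ) = R.toFun (σ / κ) (φ₀ (u, ε * r)) :=
    ⟨fun p => R.toFun (p.2.2 / κ) (φ₀ (p.1, ε * p.2.1)), fun _ _ _ => rfl⟩
  have hφeq : φ = fun p : ℝ × ℝ × ℝ => R.toFun (p.2.2 / κ) (φ₀ (p.1, ε * p.2.1)) :=
    funext fun p => hφ p.1 p.2.1 p.2.2
  have hφ0 : ∀ u r, φ (u, r, 0) = φ₀ (u, ε * r) := fun u r => by
    rw [hφ, zero_div, R.map_zero, id]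
  refine ⟨κ, η₁, R, φ, hκ, hη₁, hflow, hRpage, fun u r σ => by rw [hφ, hφ0], ?_, fun u r σ => ?_,
    fun u => ?_, fun u r σ => ?_, fun u r σ hr hσ => ?_, fun σ => ?_, fun u r σ hr => ?_⟩
  · rw [hφeq]
    have h1 : ContMDiff 𝓘(ℝ, ℝ × ℝ × ℝ) (𝓘(ℝ, ℝ).prod (𝓡∂ 4)) ∞
        (fun p : ℝ × ℝ × ℝ => ((p.2.2 / κ, φ₀ (p.1, ε * p.2.1)) : ℝ × Base g)) := by
      refine ContMDiff.prodMk ?_ ?_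
      · exact ((contDiff_snd.comp contDiff_snd).div_const κ).contMDiff
      · exact hφs.comp (contDiff_fst.prodMk (contDiff_const.mul (contDiff_fst.comp contDiff_snd))).contMDiff
    exact R.contMDiff.comp h1
  · rw [hφ, hφ, hφ1]
  · rw [hφ0, mul_zero, hφa]
  · rw [hφ]
    have h := hRpage (σ / κ) c (φ₀ (u, ε * r)) (hφp _)
    have e : ((κ * (σ / κ) : ℝ) : ℂ) = (σ : ℂ) := by rw [mul_div_cancel₀ _ hκ.ne']
    rwa [e] at h
  · rw [hφ]
    apply hwidth u (σ / κ, ε * r)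
    rw [Prod.dist_eq, Real.dist_0_eq_abs, Real.dist_0_eq_abs, max_lt_iff]
    constructor
    · rw [abs_div, abs_of_pos hκ, div_lt_iff₀ hκ]
      have : |σ| ≤ η₁ := abs_le.2 ⟨by linarith [hσ.1], hσ.2⟩
      rw [hη₁_def] at this
      nlinarith
    · rw [abs_mul, abs_of_pos hε]
      have : |r| < 1 := abs_lt.2 ⟨hr.1, hr.2⟩
      nlinarith
  · rintro ⟨u, r⟩ hur ⟨u', r'⟩ hur' h
    have h0 : R.toFun (σ / κ) (φ₀ (u, ε * r)) = R.toFun (σ / κ) (φ₀ (u', ε * r')) := by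
      have := h; simp only [hφ] at this; exact this
    exact hti hur hur' ((R.bijective _).1 h0)
  · -- orientation at the level `σ`: the transported thinned chart
    have e1 : (fun r' => (φ (u, r', σ)).1) = fun r' => θ (σ / κ, (φ₀ (u, ε * r')).1) :=
      funext fun r' => by rw [hφ, hRθ]
    have e2 : (fun u' => (φ (u', r, σ)).1) = fun u' => θ (σ / κ, (φ₀ (u', ε * r)).1) :=
      funext fun u' => by rw [hφ, hRθ]
    rw [e1, e2]
    exact chart_transport_oriented (φ₀ := fun p : ℝ × ℝ => φ₀ (p.1, ε * p.2)) hθs hθ0 hθadd hw hc hts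
      htp (hto u r hr) (σ / κ)

/-- **Sub-goal `helper_exists_orientedChartFamily` of stub `stub_M2geo`** (N1 ▸ `node_N1_move` ▸ (d) N1-mono,
brick H4-5; wave 7, lead c5).  THE INPUT OF (d) v5 EXISTS: around every smoothly embedded curve `K` of a page of
`Base g` and inside every open `U ⊇ K` there is a fibred family of annulus charts of the nearby pages, equivariant
under a global rigid page rotation (a flow), with core `K`, POSITIVELY ORIENTED AT EVERY LEVEL.
[cite: Kosinski1993, III (3.1)] -/
theorem helper_exists_orientedChartFamily : ∀ (g : ℕ) (c : ℂ) (K : Metric.sphere (0 : EuclideanSpace ℝ (Fin 2)) 1 → Literature.Topology.FourManifolds.LefschetzBase.Base g) (U : Set (Literature.Topology.FourManifolds.LefschetzBase.Base g)), ‖c‖ = 1 → Manifold.IsSmoothEmbedding (𝓡 1) (𝓡∂ 4) ∞ K → (∀ θ, K θ ∈ Literature.Topology.FourManifolds.LefschetzBase.page g c) → IsOpen U → (∀ θ, K θ ∈ U) → ∃ (κ η₁ : ℝ) (R : Literature.Topology.FourManifolds.AmbientIsotopy (𝓡∂ 4) (Literature.Topology.FourManifolds.LefschetzBase.Base g)) (φ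 : ℝ × ℝ × ℝ → Literature.Topology.FourManifolds.LefschetzBase.Base g), 0 < κ ∧ 0 < η₁ ∧ (∀ (t s : ℝ) (p : Literature.Topology.FourManifolds.LefschetzBase.Base g), R.toFun t (R.toFun s p) = R.toFun (t + s) p) ∧ (∀ (t : ℝ) (c' : ℂ) (p : Literature.Topology.FourManifolds.LefschetzBase.Base g), p ∈ Literature.Topology.FourManifolds.LefschetzBase.page g c' → R.toFun t p ∈ Literature.Topology.FourManifolds.LefschetzBase.page g (c' * Complex.exp (((κ * t : ℝ) : ℂ) * Complex.I))) ∧ (∀ u r σ, φ (u, r, σ) = R.toFun (σ / κ) (φ (u, r, 0))) ∧ ContMDiff 𝓘(ℝ, ℝ × ℝ × ℝ) (𝓡∂ 4) ∞ φ ∧ (∀ u r σ, φ (u + 1, r, σ) = φ (u, r, σ)) ∧ (∀ u, φ (u, 0, 0) = K (Literature.Topology.FourManifolds.circlePt u)) ∧ (∀ (u r σ : ℝ), φ (u, r, σ) ∈ Literature.Topology.FourManifolds.LefschetzBase.page g (c * Complex.exp ((σ : ℂ) * Complex.I))) ∧ (∀ u r σ, r ∈ Set.Ioo (-1 : ℝ)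 1 → σ ∈ Set.Icc (-η₁) η₁ → φ (u, r, σ) ∈ U) ∧ (∀ σ : ℝ, Set.InjOn (fun p : ℝ × ℝ => φ (p.1, p.2, σ)) (Set.Ico (0 : ℝ) 1 ×ˢ Set.Ioo (-1 : ℝ) 1)) ∧ (∀ (u r σ : ℝ), r ∈ Set.Ioo (-1 : ℝ) 1 → 0 < inner ℝ (deriv (fun r' => (φ (u, r', σ)).1) r) (Literature.Topology.FourManifolds.LefschetzBase.cplxJ (deriv (fun u' => (φ (u', r, σ)).1) u))) := by
  intro g c K U hc hK hKc hU hKU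
  exact exists_orientedChartFamily g hc hK hKc hU hKU

end Summit.SmoothPoincare4.SmoothPoincare4.Theorems.AcyclicBisectionExists.ModpBraidOrbits

end
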